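import Mathlib
import Summits.Ventures.PercRepro2.TypedSwitchingThree

/-!
# The union-of-boxes reflection–Harris inequality and the two-term sum form (blind cell
PercRepro2, p3 g10, 2026-08-26; `proofs/P3-SWITCH.md` §7.2, `proofs/subclaims/S2-SEPARATED.md`
§4f (20))

`PairHarris.typedCount_pair_harris_spectator` holds for arbitrary increasing events; taking for
the `y`-side events a UNION of two up-sets (resp. the complement of an intersection of two
up-sets) gives the **union-box inequality** `typedCount_union_box_le`: for a monotone state map
`σ`, a point box `α ≤ σ x ≤ δ` on the first copy and the union of the two boxes
`[β₁, γ₁] ∪ [β₂, γ₂]` on the second, the typed count is at most the typed count of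
«`α ≤ σ x` and (`β₁ ≤ σ x` or `β₂ ≤ σ x`)» × «`σ y ≤ δ` and (`σ y ≤ γ₁` or `σ y ≤ γ₂`)».
It is strictly more than the sum of the two box inequalities (whose right sides would add up
twice).  On the three-point side (bits `(p~q, p~r, q~r)`) it gives the **two-term sum form**
`typedCount_sum_two_three`: the count of «`x` has exactly `p~q`, `y` has exactly `p~r`» PLUS
the count of «`x` has exactly `p~q`, `y` has exactly `q~r`» is at most the count of
«`x` has `p~q` and (`p~r` or `q~r`), `y` has no connection» — the two-term version of the
sum form SUM3 of P3-SWITCH §7.2 (the third cross class `(pr|q, qr|p)` is NOT covered: its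
`x`-state differs, and the union over `x` picks up the extra targets, §7.2).  Own work;
standard axioms.
-/

namespace Summit.Ventures.PercRepro2

namespace CovForm

namespace PairHarris

open Classical

variable {E : Type*} [Fintype E] [DecidableEq E] {R : Type*} [Field R] [LinearOrder R]
  [IsStrictOrderedRing R]

/-- **The union-box inequality on states.**  For a monotone state map `σ`, states `α δ β₁ γ₁ β₂ γ₂`
of a preorder and a nonnegative spectator function `g`: the typed count of
`g(σ w)·1[α ≤ σ x ∧ σ x ≤ δ]·1[(σ y ≤ γ₁ ∨ σ y ≤ γ₂) ∧ (β₁ ≤ σ y ∨ β₂ ≤ σ y)]` is at most the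
typed count of `g(σ w)·1[α ≤ σ x ∧ (β₁ ≤ σ x ∨ β₂ ≤ σ x)]·1[(σ y ≤ γ₁ ∨ σ y ≤ γ₂) ∧ σ y ≤ δ]`.
(Reflection–Harris with the increasing events `P = {α ≤ σ x}`, `Q = {¬ σ x ≤ γ₁ ∧ ¬ σ x ≤ γ₂}`,
`U = {¬ σ x ≤ δ}`, `V = {β₁ ≤ σ x ∨ β₂ ≤ σ x}`.) -/
theorem typedCount_union_box_le {S : Type*} [Preorder S] (F : Finset E) (z : Config E)
    (τ : E → ℕ) (hτ : ∀ e ∈ F, τ e = 1 ∨ τ e = 2) (σ : Config E → S) (hσ : Monotone σ)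
    (α δ β₁ γ₁ β₂ γ₂ : S) (g : S → R) (hg : ∀ s, 0 ≤ g s) :
    typedCount F z τ (fun x y w => g (σ w) *
        ((if α ≤ σ x ∧ σ x ≤ δ then (1 : R) else 0) *
          (if (σ y ≤ γ₁ ∨ σ y ≤ γ₂) ∧ (β₁ ≤ σ y ∨ β₂ ≤ σ y) then (1 : R) else 0))) ≤
      typedCount F z τ (fun x y w => g (σ w) *
        ((if α ≤ σ x ∧ (β₁ ≤ σ x ∨ β₂ ≤ σ x) then (1 : R) else 0) *
          (if (σ y ≤ γ₁ ∨ σ y ≤ γ₂) ∧ σ y ≤ δ then (1 : R) else 0))) := by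
  have hP : IsUpperSet {x : Config E | decide (α ≤ σ x) = true} := by
    intro x x' hx hxP
    simp only [Set.mem_setOf_eq, decide_eq_true_eq] at hxP ⊢
    exact hxP.trans (hσ hx)
  have hQ : IsUpperSet {x : Config E | decide (¬ σ x ≤ γ₁ ∧ ¬ σ x ≤ γ₂) = true} := by
    intro x x' hx hxQ
    simp only [Set.mem_setOf_eq, decide_eq_true_eq] at hxQ ⊢
    exact ⟨fun h => hxQ.1 ((hσ hx).trans h), fun h => hxQ.2 ((hσ hx).trans h)⟩
  have hU : IsUpperSet {x : Config E | decide (¬ σ x ≤ δ) = true} := by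
    intro x x' hx hxU
    simp only [Set.mem_setOf_eq, decide_eq_true_eq] at hxU ⊢
    exact fun h => hxU ((hσ hx).trans h)
  have hV : IsUpperSet {x : Config E | decide (β₁ ≤ σ x ∨ β₂ ≤ σ x) = true} := by
    intro x x' hx hxV
    simp only [Set.mem_setOf_eq, decide_eq_true_eq] at hxV ⊢
    exact hxV.imp (fun h => h.trans (hσ hx)) (fun h => h.trans (hσ hx))
  have h := typedCount_pair_harris_spectator F z τ hτ (fun w => g (σ w)) (fun w => hg (σ w))
    {x : Config E | decide (α ≤ σ x) = true}
    {x : Config E | decide (¬ σ x ≤ γ₁ ∧ ¬ σ x ≤ γ₂) = true}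
    {x : Config E | decide (¬ σ x ≤ δ) = true}
    {x : Config E | decide (β₁ ≤ σ x ∨ β₂ ≤ σ x) = true}
    hP hQ hU hV
  refine le_trans (le_of_eq ?_) (h.trans (le_of_eq ?_))
  · congr 1
    funext x y w
    congr 1
    simp only [Set.indicator_apply, Set.mem_setOf_eq, Set.mem_compl_iff, Pi.one_apply,
      decide_eq_true_eq]
    by_cases h1 : α ≤ σ x <;> by_cases h2 : σ x ≤ δ <;> by_cases h3 : β₁ ≤ σ y <;>
      by_cases h4 : β₂ ≤ σ y <;> by_cases h5 : σ y ≤ γ₁ <;> by_cases h6 : σ y ≤ γ₂ <;>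
      simp [h1, h2, h3, h4, h5, h6]
  · congr 1
    funext x y w
    congr 1
    simp only [Set.indicator_apply, Set.mem_setOf_eq, Set.mem_compl_iff, Pi.one_apply,
      decide_eq_true_eq]
    by_cases h1 : α ≤ σ x <;> by_cases h2 : β₁ ≤ σ x <;> by_cases h3 : β₂ ≤ σ x <;>
      by_cases h4 : σ y ≤ γ₁ <;> by_cases h5 : σ y ≤ γ₂ <;> by_cases h6 : σ y ≤ δ <;>
      simp [h1, h2, h3, h4, h5, h6]

/-- The union of the two point boxes `(f,t,f)` and `(f,f,t)` on the three bits. -/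
lemma union_points_iff (s : Bool × Bool × Bool) :
    ((s ≤ (false, true, false) ∨ s ≤ (false, false, true)) ∧
        ((false, true, false) ≤ s ∨ (false, false, true) ≤ s)) ↔
      (s = (false, true, false) ∨ s = (false, false, true)) := by
  rcases s with ⟨a, b, c⟩
  cases a <;> cases b <;> cases c <;> decide

/-- `(t,f,f) ≤ s ∧ ((f,t,f) ≤ s ∨ (f,f,t) ≤ s) ↔ (t,t,f) ≤ s ∨ (t,f,t) ≤ s` on the three bits. -/
lemma join_union_iff (s : Bool × Bool × Bool) :
    ((true, false, false) ≤ s ∧ ((false, true, false) ≤ s ∨ (false, false, true) ≤ s)) ↔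
      ((true, true, false) ≤ s ∨ (true, false, true) ≤ s) := by
  rcases s with ⟨a, b, c⟩
  cases a <;> cases b <;> cases c <;> decide

/-- `(s ≤ (f,t,f) ∨ s ≤ (f,f,t)) ∧ s ≤ (t,f,f) ↔ s = (f,f,f)` on the three bits. -/
lemma meet_union_iff (s : Bool × Bool × Bool) :
    ((s ≤ (false, true, false) ∨ s ≤ (false, false, true)) ∧ s ≤ (true, false, false)) ↔
      s = (false, false, false) := by
  rcases s with ⟨a, b, c⟩
  cases a <;> cases b <;> cases c <;> decide

omit [LinearOrder R] [IsStrictOrderedRing R] in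
/-- The typed count is additive in the kernel (local copy; `TypedRed.typedCount_add` is the same
statement in another module). -/
lemma typedCount_add_kernel (F : Finset E) (z : Config E) (τ : E → ℕ)
    (K K' : Config E → Config E → Config E → R) :
    typedCount F z τ K + typedCount F z τ K' =
      typedCount F z τ (fun x y w => K x y w + K' x y w) := by
  unfold typedCount
  simp only [← Finset.sum_add_distrib]
  refine Finset.sum_congr rfl fun x _ => Finset.sum_congr rfl fun y _ =>
    Finset.sum_congr rfl fun w _ => ?_
  split_ifs <;> simp

/-- **The two-term sum form on three points (the union form).**  For a monotone three-bit state
map `σ` and a nonnegative spectator function `g`: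
`typedCount (g(σ w) · 1[σ x = p~q only] · 1[σ y = p~r only ∨ σ y = q~r only]) ≤
 typedCount (g(σ w) · 1[(t,t,f) ≤ σ x ∨ (t,f,t) ≤ σ x] · 1[σ y = (f,f,f)])`. -/
theorem typedCount_switching_union_three (F : Finset E) (z : Config E) (τ : E → ℕ)
    (hτ : ∀ e ∈ F, τ e = 1 ∨ τ e = 2) (σ : Config E → Bool × Bool × Bool) (hσ : Monotone σ)
    (g : Bool × Bool × Bool → R) (hg : ∀ s, 0 ≤ g s) :
    typedCount F z τ (fun x y w => g (σ w) *
        ((if σ x = (true, false, false) then (1 : R) else 0) *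
          (if σ y = (false, true, false) ∨ σ y = (false, false, true) then (1 : R) else 0))) ≤
      typedCount F z τ (fun x y w => g (σ w) *
        ((if (true, true, false) ≤ σ x ∨ (true, false, true) ≤ σ x then (1 : R) else 0) *
          (if σ y = (false, false, false) then (1 : R) else 0))) := by
  have h := typedCount_union_box_le (R := R) F z τ hτ σ hσ (true, false, false) (true, false, false)
    (false, true, false) (false, true, false) (false, false, true) (false, false, true) g hg
  refine le_trans (le_of_eq ?_) (h.trans (le_of_eq ?_))
  · congr 1
    funext x y w
    simp only [box_point_iff, union_points_iff]
  · congr 1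
    funext x y w
    simp only [join_union_iff, meet_union_iff]

/-- **The two-term sum form on three points (the sum form, SUM3⁻).**
`c(X, pq|r, pr|q) + c(X, pq|r, qr|p) ≤ c(X, x ≥ pqr-join, SEP)`: the count of «`x` has exactly
`p~q`, `y` exactly `p~r`» plus the count of «`x` has exactly `p~q`, `y` exactly `q~r`» is at most
the count of «`x` has `p~q` and one of `p~r`, `q~r`; `y` has no connection». -/
theorem typedCount_sum_two_three (F : Finset E) (z : Config E) (τ : E → ℕ)
    (hτ : ∀ e ∈ F, τ e = 1 ∨ τ e = 2) (σ : Config E → Bool × Bool × Bool) (hσ : Monotone σ)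
    (g : Bool × Bool × Bool → R) (hg : ∀ s, 0 ≤ g s) :
    typedCount F z τ (fun x y w => g (σ w) *
        ((if σ x = (true, false, false) then (1 : R) else 0) *
          (if σ y = (false, true, false) then (1 : R) else 0))) +
      typedCount F z τ (fun x y w => g (σ w) *
        ((if σ x = (true, false, false) then (1 : R) else 0) *
          (if σ y = (false, false, true) then (1 : R) else 0))) ≤
      typedCount F z τ (fun x y w => g (σ w) *
        ((if (true, true, false) ≤ σ x ∨ (true, false, true) ≤ σ x then (1 : R) else 0) *
          (if σ y = (false, false, false) then (1 : R) else 0))) := by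
  rw [typedCount_add_kernel]
  refine le_trans (le_of_eq ?_) (typedCount_switching_union_three F z τ hτ σ hσ g hg)
  congr 1
  funext x y w
  by_cases h1 : σ x = (true, false, false) <;> by_cases h2 : σ y = (false, true, false) <;>
    by_cases h3 : σ y = (false, false, true) <;> simp [h1, h2, h3]

end PairHarris

end CovForm

end Summit.Ventures.PercRepro2
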